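import Literature.NumberTheory.Automorphic.AshSmithTheoryHeckeNormCharacterProofs
import Literature.NumberTheory.GaloisRepresentations.ModNCyclotomicCharacter
import Literature.NumberTheory.LFunctions.NormDirichletCharacter
import Literature.NumberTheory.LFunctions.PrimesInRayClasses
import HarnessLib

/-!
# Ash (2003), *Smith theory and Hecke operators* — proofs towards the named fact
# `Ash2003_inducedRayClassCharacter_attached`: the ray class characters `χ ∘ N_{L/ℚ}` and their
# Galois avatars exist, so Theorem 1.1 holds unconditionally for them

Topic `NumberTheory/Automorphic`; companion of `Literature.NumberTheory.Automorphic.AshSmithTheoryHecke`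
(the named fact `Ash2003_inducedRayClassCharacter_attached` = A. Ash, *Smith theory and Hecke
operators*, J. Algebra **259** (2003) 43–58 [Ash2003], Thm. 1.1 / Cor. 4.4).  The fact quantifies
over a ray class character `θ` of `L = ℚ(ζ_p)` modulo `(pN)` AND a Galois avatar `ϑ` of `θ`
(`Ash2003.IsGaloisAvatar`, which the fact does not construct: "exists by class field theory").
`AshSmithTheoryHeckeNormCharacterProofs` proved its conclusion for every `θ` with
`θ([w]) = χ(N w)` (`χ` a Dirichlet character mod `pN` with values in `F`) and every avatar `ϑ`.
This file supplies BOTH objects for this family, making that case unconditional and the fact's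
hypotheses visibly inhabited beyond `θ = 𝟙`:

* `Ash2003.exists_rayClassCharacter_norm` (any number field `L`, any `m ≥ 1`, any commutative
  ring `F`, `χ : (ℤ/m) → F` multiplicative): there is a character `θ_χ` of the (narrow) ray class
  group `Cl_L^{(m)}` (tree `RayClassGroup`) with `θ_χ([w]) = χ(N w)` at the primes `w ∤ m` — the
  Artin homomorphism (`rayClassArtinHom`, [NeukirchANT1999, VI (7.1)]) of `w ↦ χ(N w)`, which
  kills the ray because `N((b)) ≡ N((c)) (mod m)` for `b ≡ c (mod m)`, `b/c ≫ 0`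
  (`natCast_absNorm_span_singleton_eq` of `LFunctions/NormDirichletCharacter`);
* `Ash2003.isGaloisAvatar_ofCharacter_modNCyclotomicCharacter`: the character
  `ϑ_χ = χ ∘ χ̄_m : Γ_L → F^×` (`χ̄_m` the mod-`m` cyclotomic character of `Γ_L`, tree
  `modNCyclotomicCharacter`, as a rank-one framed representation `FramedRep.ofCharacter`) is a
  Galois avatar of `θ_χ`: unramified at `w ∤ m` (`modNCyclotomicCharacter_eq_one_of_mem_inertia`)
  with `ϑ_χ(Frob_w) = χ(q_w) = χ(N w)` (`modNCyclotomicCharacter_eq_residueCard_of_isArithFrobAt`);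
* `Ash2003.exists_isEigenclass_isAttached_induce_modNCyclotomicCharacter`: hence, for every prime
  `p`, `N ≥ 1`, field `F` of characteristic `p` (a topological ring) and Dirichlet character
  `χ` mod `pN` with values in `F`, `Ind_{Γ_{ℚ(ζ_p)}}^{Γ_ℚ} (χ ∘ χ̄_{pN})` is attached to a Hecke
  eigenclass in `H⁰(X(pN), F)` — [Ash2003, Thm. 1.1] for `θ = χ ∘ N_{L/ℚ}`, with no avatar
  hypothesis left.

## References

* A. Ash, *Smith theory and Hecke operators*, J. Algebra 259 (2003) 43–58, Thm. 1.1, §1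
  ("by class field theory we can view `θ` as a character of `G_L`") [Ash2003].
* J. Neukirch, *Algebraic Number Theory* (1999), Ch. VI §7 Thm. (7.1), Ch. VII (6.8)
  [NeukirchANT1999].
-/

noncomputable section

open scoped NumberField
open IsDedekindDomain Polynomial

namespace Literature.NumberTheory.Automorphic

namespace Ash2003

open GaloisRepresentations LFunctions LFunctions.AbelianDensity

/-! ### The ray class character `χ ∘ N` -/

section NormCharacter

variable {L : Type*} [Field L] [NumberField L] {F : Type*} [CommRing F] {m : ℕ}

omit [NumberField L] in
/-- A prime `w` coprime to `(m)` does not contain `m`. [folklore] -/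
theorem natCast_not_mem_of_isCoprime {w : HeightOneSpectrum (𝓞 L)}
    (hw : IsCoprime w.asIdeal (Ideal.span {((m : ℕ) : 𝓞 L)})) : ((m : ℕ) : 𝓞 L) ∉ w.asIdeal := by
  intro hmem
  rw [Ideal.isCoprime_iff_sup_eq] at hw
  have hle : Ideal.span {((m : ℕ) : 𝓞 L)} ≤ w.asIdeal := (Ideal.span_singleton_le_iff_mem _).2 hmem
  exact w.isPrime.ne_top (top_le_iff.1 (hw.symm.le.trans (sup_le le_rfl hle)))

open scoped Classical in
/-- **The Artin symbol of `w ↦ χ(N w)` is `𝔞 ↦ χ(N 𝔞)`** on the nonzero ideals prime to `m`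
(multiplicativity of the absolute norm and of `χ`; induction on the prime factorisation).
[folklore] -/
theorem coe_artinSymbol_norm (χ : MulChar (ZMod m) F) {I : Ideal (𝓞 L)} (hI : I ≠ ⊥)
    (hIm : IsCoprime I (Ideal.span {((m : ℕ) : 𝓞 L)})) :
    ((artinSymbol (fun w : HeightOneSpectrum (𝓞 L) =>
        if h : IsUnit ((w.residueCard : ℕ) : ZMod m) then MulChar.toUnitHom χ h.unit else 1) I :
        Fˣ) : F) = χ ((Ideal.absNorm I : ℕ) : ZMod m) := by
  induction I using UniqueFactorizationMonoid.induction_on_prime with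
  | h₁ => exact absurd Submodule.zero_eq_bot hI
  | h₂ I hu =>
    obtain rfl : I = ⊤ := Ideal.isUnit_iff.mp hu
    rw [artinSymbol_top, Units.val_one, Ideal.absNorm_top, Nat.cast_one, map_one]
  | h₃ J P hJ0 hP ih =>
    have hP0 : P ≠ ⊥ := hP.ne_zero
    haveI : P.IsPrime := Ideal.isPrime_of_prime hP
    set v : HeightOneSpectrum (𝓞 L) := ⟨P, inferInstance, hP0⟩ with hv
    have hPm : IsCoprime P (Ideal.span {((m : ℕ) : 𝓞 L)}) := hIm.of_mul_left_left
    have hJm : IsCoprime J (Ideal.span {((m : ℕ) : 𝓞 L)}) := hIm.of_mul_left_right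
    have hmv : ((m : ℕ) : 𝓞 L) ∉ v.asIdeal := natCast_not_mem_of_isCoprime hPm
    have hunit : IsUnit ((v.residueCard : ℕ) : ZMod m) := (isUnit_natCast_absNorm_iff v).2 hmv
    rw [artinSymbol_mul _ hP0 hJ0, Units.val_mul, ih hJ0 hJm, show P = v.asIdeal from rfl,
      artinSymbol_asIdeal, dif_pos hunit, MulChar.coe_toUnitHom, IsUnit.unit_spec, map_mul,
      Nat.cast_mul, map_mul]
    rfl

open scoped Classical in
/-- **`w ↦ χ(N w)` kills the narrow ray modulo `(m)`** (`ArtinKillsRay`): for nonzero `b ≡ c (mod m)`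
with `c` prime to `m` and `b/c` totally positive, `χ(N((b))) = χ(N((c)))` since
`N((b)) ≡ N((c)) (mod m)` (`natCast_absNorm_span_singleton_eq`). [folklore] -/
theorem artinKillsRay_norm (χ : MulChar (ZMod m) F) :
    ArtinKillsRay (Ideal.span {((m : ℕ) : 𝓞 L)}) (fun w : HeightOneSpectrum (𝓞 L) =>
      if h : IsUnit ((w.residueCard : ℕ) : ZMod m) then MulChar.toUnitHom χ h.unit else 1) := by
  intro b c hb hc hcop hbc hpos
  have hb0 : Ideal.span {b} ≠ ⊥ := by rwa [Ne, Ideal.span_singleton_eq_bot]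
  have hc0 : Ideal.span {c} ≠ ⊥ := by rwa [Ne, Ideal.span_singleton_eq_bot]
  -- `(b)` is prime to `m` as well: `c = b - (b - c) ∈ (b) + (m)`
  have hcopb : IsCoprime (Ideal.span {b}) (Ideal.span {((m : ℕ) : 𝓞 L)}) := by
    rw [Ideal.isCoprime_iff_sup_eq] at hcop ⊢
    rw [eq_top_iff, ← hcop]
    refine sup_le ((Ideal.span_singleton_le_iff_mem _).2 ?_) le_sup_right
    have : c = b - (b - c) := by ring
    rw [this]
    exact Ideal.sub_mem _ (Ideal.mem_sup_left (Ideal.mem_span_singleton_self b))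
      (Ideal.mem_sup_right hbc)
  refine Units.ext ?_
  rw [coe_artinSymbol_norm χ hb0 hcopb, coe_artinSymbol_norm χ hc0 hcop,
    natCast_absNorm_span_singleton_eq hb hc hbc hpos]

open scoped Classical in
/-- **The ray class character `θ_χ = χ ∘ N_{L/ℚ}`**: for a number field `L`, `m ≥ 1` and a
multiplicative character `χ` of `ℤ/m` with values in a commutative ring `F`, there is a character
`θ_χ` of the narrow ray class group `Cl_L^{(m)}` (tree `RayClassGroup`) with `θ_χ([w]) = χ(N w)` for
every prime `w` coprime to `(m)` — the Artin homomorphism of `w ↦ χ(N w)` (`rayClassArtinHom`,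
[NeukirchANT1999, Ch. VI §7 Thm. (7.1)]), well defined by `artinKillsRay_norm`.
[cite: NeukirchANT1999, Ch. VI §7 Thm. (7.1)] -/
theorem exists_rayClassCharacter_norm (χ : MulChar (ZMod m) F)
    (h𝔪 : Ideal.span {((m : ℕ) : 𝓞 L)} ≠ ⊥) :
    ∃ θ : RayClassGroup (Ideal.span {((m : ℕ) : 𝓞 L)}) →* Fˣ,
      ∀ (w : HeightOneSpectrum (𝓞 L)) (hw : IsCoprime w.asIdeal (Ideal.span {((m : ℕ) : 𝓞 L)})),
        ((θ (integralRayClass (Ideal.span {((m : ℕ) : 𝓞 L)}) h𝔪 ⟨w.asIdeal, w.ne_bot, hw⟩) : Fˣ) :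
          F) = χ ((w.residueCard : ℕ) : ZMod m) := by
  refine ⟨rayClassArtinHom h𝔪 (artinKillsRay_norm χ), fun w hw => ?_⟩
  have hunit : IsUnit ((w.residueCard : ℕ) : ZMod m) :=
    (isUnit_natCast_absNorm_iff w).2 (natCast_not_mem_of_isCoprime hw)
  unfold integralRayClass
  rw [rayClassArtinHom_mk, artinHom_unitsMk0_coeIdeal _ w.ne_bot, artinSymbol_asIdeal,
    dif_pos hunit, MulChar.coe_toUnitHom, IsUnit.unit_spec]

end NormCharacter

/-! ### The cyclotomic avatar `χ ∘ χ̄_m : Γ_L → F^×` -/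

section Avatar

variable (L : Type*) [Field L] [NumberField L] {F : Type*} [CommRing F] [TopologicalSpace F]
  [IsTopologicalRing F] (m : ℕ) [NeZero m]

/-- `η ∘ χ̄_m : Γ_L → F^×` is continuous (locally constant: `χ̄_m` is `1` near `1`,
`modNCyclotomicCharacter_eventually_eq_one`; compare `dirichletGaloisCharacter`). [folklore] -/
theorem continuous_comp_modNCyclotomicCharacter (η : (ZMod m)ˣ →* Fˣ) :
    Continuous (η.comp (modNCyclotomicCharacter L m)) := by
  refine continuous_of_continuousAt_one (η.comp (modNCyclotomicCharacter L m)) ?_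
  rw [ContinuousAt, map_one]
  refine Filter.Tendsto.mono_right ?_ (pure_le_nhds 1)
  rw [Filter.tendsto_pure]
  filter_upwards [modNCyclotomicCharacter_eventually_eq_one L m] with σ hσ
  simp only [MonoidHom.coe_comp, Function.comp_apply, hσ, map_one]

variable {L m}

omit [NumberField L] [NeZero m] in
/-- A prime `𝔓` of `ℤ̄_L` above a prime `w ∌ m` of `L` does not contain `m`. [folklore] -/
theorem natCast_not_mem_of_mem_primesAbove {w : HeightOneSpectrum (𝓞 L)}
    (hmw : ((m : ℕ) : 𝓞 L) ∉ w.asIdeal) {𝔓 : Ideal (absIntegers (𝓞 L) L)}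
    (h𝔓 : 𝔓 ∈ w.primesAbove) : ((m : ℕ) : absIntegers (𝓞 L) L) ∉ 𝔓 := by
  intro h
  apply hmw
  rw [h𝔓.2.over]
  exact Ideal.mem_comap.2 (by rwa [map_natCast])

/-- **The cyclotomic avatar of `χ ∘ N`.**  Let `χ` be a multiplicative character of `ℤ/m` with
values in a topological commutative ring `F`, `ϑ_χ = χ ∘ χ̄_m : Γ_L → F^×` (`χ̄_m` the mod-`m`
cyclotomic character of `Γ_L`, `modNCyclotomicCharacter`; as a rank-one framed representation,
`FramedRep.ofCharacter`) and `θ` a character of `Cl_L^{(m)}` with `θ([w]) = χ(N w)` at the primes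
`w ∤ m` (`exists_rayClassCharacter_norm`).  Then `ϑ_χ` is a Galois avatar of `θ`
(`Ash2003.IsGaloisAvatar`): at `w ∤ m` it is unramified (`χ̄_m` is trivial on inertia,
`modNCyclotomicCharacter_eq_one_of_mem_inertia`) and an arithmetic Frobenius has characteristic
polynomial `X - χ(q_w) = X - θ([w])` (`χ̄_m(Frob_w) = q_w`,
`modNCyclotomicCharacter_eq_residueCard_of_isArithFrobAt`).  This is "by class field theory we can
view `θ` as a character of `G_L`" ([Ash2003, §1]) for the characters factoring through the norm,
where the cyclotomic character does the job. [cite: Ash2003, §1] -/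
theorem isGaloisAvatar_ofCharacter_modNCyclotomicCharacter (χ : MulChar (ZMod m) F) (h𝔪 : Ideal.span {((m : ℕ) : 𝓞 L)} ≠ ⊥)
    (θ : RayClassGroup (Ideal.span {((m : ℕ) : 𝓞 L)}) →* Fˣ)
    (hθ : ∀ (w : HeightOneSpectrum (𝓞 L)) (hw : IsCoprime w.asIdeal (Ideal.span {((m : ℕ) : 𝓞 L)})),
      ((θ (integralRayClass (Ideal.span {((m : ℕ) : 𝓞 L)}) h𝔪 ⟨w.asIdeal, w.ne_bot, hw⟩) : Fˣ) :
        F) = χ ((w.residueCard : ℕ) : ZMod m)) :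
    IsGaloisAvatar h𝔪 θ (FramedRep.ofCharacter
      ⟨(MulChar.toUnitHom χ).comp (modNCyclotomicCharacter L m),
        continuous_comp_modNCyclotomicCharacter L m (MulChar.toUnitHom χ)⟩) := by
  intro w hw
  have hmw : ((m : ℕ) : 𝓞 L) ∉ w.asIdeal := natCast_not_mem_of_isCoprime hw
  refine ⟨fun 𝔓 h𝔓 σ hσ => ?_, fun 𝔓 h𝔓 σ hσ => ?_⟩
  · -- unramified: `χ̄_m(σ) = 1` on inertia
    haveI : 𝔓.IsPrime := h𝔓.1
    have h1 : modNCyclotomicCharacter L m σ = 1 :=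
      modNCyclotomicCharacter_eq_one_of_mem_inertia (natCast_not_mem_of_mem_primesAbove hmw h𝔓) hσ
    refine Matrix.GeneralLinearGroup.ext fun i j => ?_
    rw [FramedRep.ofCharacter_apply_coe, Units.val_one, Subsingleton.elim i j, Matrix.one_apply_eq]
    change (((MulChar.toUnitHom χ) (modNCyclotomicCharacter L m σ) : Fˣ) : F) = 1
    rw [h1, map_one, Units.val_one]
  · -- Frobenius: `χ̄_m(Frob_w) = q_w`
    rw [FramedRep.charpoly_ofCharacter, hθ w hw]
    congr 2
    change (((MulChar.toUnitHom χ) (modNCyclotomicCharacter L m σ) : Fˣ) : F) = _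
    rw [MulChar.coe_toUnitHom,
      modNCyclotomicCharacter_eq_residueCard_of_isArithFrobAt h𝔓
        (natCast_not_mem_of_mem_primesAbove hmw h𝔓) hσ]

end Avatar

/-! ### Theorem 1.1 for `θ = χ ∘ N`, unconditionally -/

/-- **[Ash2003, Thm. 1.1] for the characters `χ ∘ N_{ℚ(ζ_p)/ℚ}`, with no avatar hypothesis.**  For a
prime `p`, `N` with `pN ≠ 0`, a field `F` of characteristic `p` which is a topological ring (e.g.
discrete, as in the fact) and a Dirichlet character `χ` modulo `pN` with values in `F`, the induced
representation `Ind_{Γ_{ℚ(ζ_p)}}^{Γ_ℚ} (χ ∘ χ̄_{pN})` of the cyclotomic avatar of `χ ∘ N` is attached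
to a Hecke eigenclass in `H⁰(X(pN), F)` (`Ash2003.IsEigenclass`, `Ash2003.IsAttached`):
`exists_isEigenclass_isAttached_of_isGaloisAvatar_of_norm` applied to the ray class character
`θ_χ` (`exists_rayClassCharacter_norm`) and its avatar
(`isGaloisAvatar_ofCharacter_modNCyclotomicCharacter`). [cite: Ash2003, Thm. 1.1 and Cor. 4.4] -/
theorem exists_isEigenclass_isAttached_induce_modNCyclotomicCharacter (p : ℕ) [hp : Fact p.Prime]
    (N : ℕ) [NeZero (p * N)] (F : Type) [Field F] [Algebra (ZMod p) F] [TopologicalSpace F]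
    [IsTopologicalRing F] (χ : MulChar (ZMod (p * N)) F) :
    ∃ (i : ℕ) (α : cohomology (p - 1) (p * N) F i) (a : HeightOneSpectrum (𝓞 ℚ) → ℕ → F),
      IsEigenclass (p - 1) (p * N) F i α a ∧
        IsAttached p (p * N)
          (FramedGaloisRep.induce ℚ (finrank_cyclotomicField p)
            (FramedRep.ofCharacter
              ⟨(MulChar.toUnitHom χ).comp (modNCyclotomicCharacter (CyclotomicField p ℚ) (p * N)),
                continuous_comp_modNCyclotomicCharacter (CyclotomicField p ℚ) (p * N)
                  (MulChar.toUnitHom χ)⟩)) a := by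
  have hN : N ≠ 0 := (mul_ne_zero_iff.1 (NeZero.ne (p * N))).2
  obtain ⟨θ, hθ⟩ := exists_rayClassCharacter_norm (L := CyclotomicField p ℚ) χ
    (modulus_ne_bot (CyclotomicField p ℚ) (mul_ne_zero (Nat.Prime.ne_zero hp.out) hN))
  exact exists_isEigenclass_isAttached_of_isGaloisAvatar_of_norm p hN F χ θ hθ _
    (isGaloisAvatar_ofCharacter_modNCyclotomicCharacter χ _ θ hθ)

end Ash2003

end Literature.NumberTheory.Automorphic
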